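import Summits.NavierStokesRegularity.FunctionalMining.StretchingLaminateCalculus
import Mathlib.Tactic.Linarith
import HarnessLib

/-!
# FunctionalMining — K1-Q1 laminates: the SUPERMARTINGALE PRINCIPLE on div-free lamination trees (kernel shape of step (K1) of a Burkholder-type laminate cap) — dict seat, staged

Search for candidate a priori estimates; no regularity claim.

Cell `pub-nsfunc`, dict seat (gen 11), STAGED for the prove seat (target tree path
`Summits/NavierStokesRegularity/FunctionalMining/StretchingLaminateSupermartingale.lean`; file AFTER
`StretchingLaminateCalculus.lean`, which is in the tree). This is §6 of the dict's staged
`StretchingLaminateMartingale.lean` v2 (8ba837d578eaf57d); the tree copy of that module (p219419) was filed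
from v1 and does not contain it, so the section is re-staged here as its own small module — no declaration of
the tree is restated.

CONTENT (typed question K1-Q1/V, `HOME/DICTIONARY.md` §14b; bank THEOREM L-CAP-B, steps (K1)–(K3)):
* `Tree.leafSumR f G W T = Σ_L W_L f(G_L)` — the real-valued weighted leaf functional of a node functional
  `f : Grad → ℝ` (same recursion as the tree's `leafSum`; weights rational, values real), the shape in which a
  transcendental node functional such as Burkholder's `u_λ` is summed over a tree;
* `Tree.leafSumR_le_of_supersplit` — the SUPERMARTINGALE PRINCIPLE: if `λ f(G₊) + (1−λ) f(G₋) ≤ f(G)` at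
  every div-free split with `0 < λ < 1` (`G₊ = G.layer (1−λ) s`, `G₋ = G.layer (−λ) s`, `s.dot = 0`), then on
  every VALID tree `Σ_L W_L f(G_L) ≤ W·f(G)` for `W ≥ 0`;
* `Tree.allStates` (Bool-valued node test), `Tree.leafSumR_le_of_supersplit_on` — the same localised to an
  admissible region `A` of states containing every node of the tree; `Tree.leafSumR_eq_of_split` (martingale case).

HONEST SIZE. Elementary induction; NOTHING is asserted about any particular `f` — for Burkholder's `u_λ` the
super-split inequality is a published theorem (Burkholder 1991, LNM 1464, Thm. 8.1 / (8.10)) to be CITED as a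
named Literature fact by the literature seat, never re-proved in this tree; the pointwise majorisation (K3) is
a separate exact certificate. Not a bound on `C⋆`; nothing about Navier–Stokes solutions.
-/

noncomputable section

namespace Summit.NavierStokesRegularity.FunctionalMining

namespace Laminate

namespace Tree

/-- **Real-valued weighted leaf functional** `Σ_L W_L f(G_L)` (same recursion as `leafSum`, values in `ℝ`,
weights still rational) — the shape in which a transcendental node functional such as Burkholder's `u_λ`
would be summed over a tree. [ours; bookkeeping] -/
noncomputable def leafSumR (f : Grad → ℝ) (G : Grad) (W : ℚ) : Tree → ℝ
  | leaf => (W : ℝ) * f G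
  | node s p m => leafSumR f (G.layer (1 - s.lam) s) (W * s.lam) p
      + leafSumR f (G.layer (-s.lam) s) (W * (1 - s.lam)) m

/-- **Supermartingale principle** (the kernel shape of step (K1) of a Burkholder-type laminate cap): if a
node functional `f` satisfies the SUPER-split inequality `λ f(G₊) + (1−λ) f(G₋) ≤ f(G)` at every div-free
split with `0 < λ < 1`, then on every VALID tree `Σ_L W_L f(G_L) ≤ W f(G)` for `W ≥ 0`. Nothing here asserts
the inequality for any particular `f`; for `u_λ` it is a published theorem (Burkholder 1991, Thm 8.1), to be
CITED as a named Literature fact, never re-proved in this tree. Search for candidate a priori estimates; no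
regularity claim. [ours; elementary] -/
theorem leafSumR_le_of_supersplit (f : Grad → ℝ)
    (hf : ∀ (G : Grad) (s : Split), 0 < s.lam → s.lam < 1 → s.dot = 0 →
      (s.lam : ℝ) * f (G.layer (1 - s.lam) s) + (1 - (s.lam : ℝ)) * f (G.layer (-s.lam) s) ≤ f G)
    (T : Tree) (hT : T.valid = true) : ∀ (G : Grad) (W : ℚ), 0 ≤ W → T.leafSumR f G W ≤ (W : ℝ) * f G := by
  induction T with
  | leaf => intro G W _; simp [leafSumR]
  | node s p m ihp ihm =>
      intro G W hW
      obtain ⟨h0, h1, hdot, hp, hm⟩ := valid_node hT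
      have hWl : 0 ≤ W * s.lam := mul_nonneg hW h0.le
      have hWm : 0 ≤ W * (1 - s.lam) := mul_nonneg hW (by linarith)
      have hp' := ihp hp (G.layer (1 - s.lam) s) (W * s.lam) hWl
      have hm' := ihm hm (G.layer (-s.lam) s) (W * (1 - s.lam)) hWm
      have key := hf G s h0 h1 hdot
      have hWR : (0 : ℝ) ≤ (W : ℝ) := by exact_mod_cast hW
      simp only [leafSumR]
      push_cast at hp' hm' ⊢
      nlinarith [mul_le_mul_of_nonneg_left key hWR]

/-- The node-state test: every node state of the tree `T` rooted at `G` passes the Boolean region test `A`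
(recursion along the tree's own splits; `Bool`-valued, so concrete trees are checked by `decide`/`rfl`).
[ours; bookkeeping] -/
def allStates (A : Grad → Bool) : Grad → Tree → Bool
  | G, leaf => A G
  | G, node s p m => A G && allStates A (G.layer (1 - s.lam) s) p && allStates A (G.layer (-s.lam) s) m

/-- **Supermartingale principle on an admissible region** `A`: if every node state lies in `A` and the
super-split inequality holds at states of `A`, then `Σ_L W_L f(G_L) ≤ W f(G)` on every valid tree, `W ≥ 0`.
Search for candidate a priori estimates; no regularity claim. [ours; elementary] -/
theorem leafSumR_le_of_supersplit_on (A : Grad → Bool) (f : Grad → ℝ)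
    (hf : ∀ (G : Grad) (s : Split), A G = true → 0 < s.lam → s.lam < 1 → s.dot = 0 →
      (s.lam : ℝ) * f (G.layer (1 - s.lam) s) + (1 - (s.lam : ℝ)) * f (G.layer (-s.lam) s) ≤ f G)
    (T : Tree) (hT : T.valid = true) :
    ∀ (G : Grad) (W : ℚ), allStates A G T = true → 0 ≤ W → T.leafSumR f G W ≤ (W : ℝ) * f G := by
  induction T with
  | leaf => intro G W _ _; simp [leafSumR]
  | node s p m ihp ihm =>
      intro G W hA hW
      obtain ⟨h0, h1, hdot, hp, hm⟩ := valid_node hT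
      simp only [allStates, Bool.and_eq_true] at hA
      obtain ⟨⟨hAG, hAp⟩, hAm⟩ := hA
      have hWl : 0 ≤ W * s.lam := mul_nonneg hW h0.le
      have hWm : 0 ≤ W * (1 - s.lam) := mul_nonneg hW (by linarith)
      have hp' := ihp hp (G.layer (1 - s.lam) s) (W * s.lam) hAp hWl
      have hm' := ihm hm (G.layer (-s.lam) s) (W * (1 - s.lam)) hAm hWm
      have key := hf G s hAG h0 h1 hdot
      have hWR : (0 : ℝ) ≤ (W : ℝ) := by exact_mod_cast hW
      simp only [leafSumR]
      push_cast at hp' hm' ⊢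
      nlinarith [mul_le_mul_of_nonneg_left key hWR]

/-- With EQUALITY in the split hypothesis the principle is an identity (sanity: the martingale case).
[ours; elementary] -/
theorem leafSumR_eq_of_split (f : Grad → ℝ)
    (hf : ∀ (G : Grad) (s : Split), 0 < s.lam → s.lam < 1 → s.dot = 0 →
      (s.lam : ℝ) * f (G.layer (1 - s.lam) s) + (1 - (s.lam : ℝ)) * f (G.layer (-s.lam) s) = f G)
    (T : Tree) (hT : T.valid = true) : ∀ (G : Grad) (W : ℚ), T.leafSumR f G W = (W : ℝ) * f G := by
  induction T with
  | leaf => intro G W; simp [leafSumR]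
  | node s p m ihp ihm =>
      intro G W
      obtain ⟨h0, h1, hdot, hp, hm⟩ := valid_node hT
      have hp' := ihp hp (G.layer (1 - s.lam) s) (W * s.lam)
      have hm' := ihm hm (G.layer (-s.lam) s) (W * (1 - s.lam))
      have key := hf G s h0 h1 hdot
      simp only [leafSumR, hp', hm']
      push_cast
      linear_combination (W : ℝ) * key

end Tree

end Laminate

end Summit.NavierStokesRegularity.FunctionalMining

end
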